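import Mathlib
import HarnessLib
import Summits.CriticalPhenomena.Ising3DConformalLimit.Theses.LatticeSDPCertificates
import Literature.Probability.LatticeModels.PointwiseScalingLimitEtaExists
import Literature.Probability.LatticeModels.CriticalEtaUpperDCPProofs
import Literature.Probability.LatticeModels.FKIsingRSWTwoPoint

/-!
# WINDOW ⇒ top-heavy bubble (route LatticeSDPCertificates, item stmt-CriticalPhenomena-5509)

Write `G = ⟨σ₀σ_x⟩⁺_{β_c(3)} = criticalTwoPoint 3` and `a_n = G(n e₁)`. WINDOW is the hypothesis
`c (n/m)^{-(3/2-ε)} a_m ≤ a_n` for all `1 ≤ m ≤ n` (some `ε, c > 0`). We prove the support item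
`WindowGivesTopHeavyBubble` of the route: WINDOW implies the top-heavy bubble bound
`Σ_{w ∈ Λ_R} G(w)² ≤ C R³ a_R²` for all `R ≥ 1`.

Proof. Shrink `ε` to `min ε ½` (WINDOW is monotone in `ε` since `n/m ≥ 1`). For `w ≠ 0` with
`m = ‖w‖_∞ ≤ R`, the Messager–Miracle-Solé sandwich (`criticalTwoPoint_axis_sandwich`) gives
`G(w) ≤ a_m`, and WINDOW between the scales `m ≤ R`, squared, gives
`G(w)² ≤ c⁻² R^{3-2ε} ‖w‖^{-(3-2ε)} a_R²`. Summing over shells with `|∂Λ_m| ≤ 54 m²`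
(`sum_box_erase_norm_rpow_le`) and `Σ_{m < R} (m+1)^{2ε-1} ≤ R^{2ε}/(2ε)`
(`sum_range_rpow_sub_one_le`) bounds the sum over `w ≠ 0` by `54/(2ε c²) · R³ a_R²`; the term
`w = 0` is `G(0)² = 1 ≤ R³ a_R² /(c² a_1²)` by WINDOW between the scales `1 ≤ R`. Hence
`C = 1/(c² a_1²) + 54/(2ε c²)`.

References: Messager–Miracle-Solé (J. Stat. Phys. 1977) for the sandwich; the counting is that of
Duminil-Copin–Panis 2025, proof of Thm 1.5. No definitions are introduced.
-/

namespace Summit.CriticalPhenomena.Ising3DConformalLimit.Theorems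

open Literature.Probability.LatticeModels Finset
open Summit.CriticalPhenomena.Ising3DConformalLimit.Theses.LatticeSDPCertificates

/-- Pointwise step. WINDOW with exponent `3/2 - ε` and constant `c`, together with the MMS
sandwich `G(w) ≤ G(‖w‖_∞ e₁)`, gives for `0 ≠ w ∈ Λ_R`
`G(w)² ≤ (a_R² R^{3-2ε} / c²) · ‖w‖^{-(3-2ε)}`. [folklore] -/
theorem criticalTwoPoint_sq_le_of_window {ε c : ℝ} (hc : 0 < c)
    (hwin : ∀ m n : ℕ, 1 ≤ m → m ≤ n →
      c * ((n : ℝ) / m) ^ (-((3:ℝ) / 2 - ε)) * criticalTwoPoint 3 (Pi.single 0 (m : ℤ)) ≤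
        criticalTwoPoint 3 (Pi.single 0 (n : ℤ)))
    {R : ℕ} {w : Site 3} (hw : w ≠ 0) (hwR : w ∈ box 3 R) :
    criticalTwoPoint 3 w ^ 2 ≤
      criticalTwoPoint 3 (Pi.single 0 (R : ℤ)) ^ 2 * (R : ℝ) ^ ((3:ℝ) - 2 * ε) / c ^ 2 *
        ‖w‖ ^ (-((3:ℝ) - 2 * ε)) := by
  have hm1 : 1 ≤ Site.supNorm w :=
    Nat.one_le_iff_ne_zero.2 fun h => hw (Site.supNorm_eq_zero_iff.1 h)
  have hmR : Site.supNorm w ≤ R := mem_box_iff_supNorm_le.1 hwR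
  have hGw : criticalTwoPoint 3 w ≤ criticalTwoPoint 3 (Pi.single 0 (Site.supNorm w : ℤ)) :=
    (criticalTwoPoint_axis_sandwich hm1).2
  have h0w : 0 ≤ criticalTwoPoint 3 w := criticalTwoPoint_nonneg' _
  have ham : 0 ≤ criticalTwoPoint 3 (Pi.single 0 ((Site.supNorm w : ℕ) : ℤ)) :=
    criticalTwoPoint_nonneg' _
  have hmpos : (0:ℝ) < (Site.supNorm w : ℕ) := by exact_mod_cast hm1
  have hRpos : (0:ℝ) < R := by exact_mod_cast lt_of_lt_of_le hm1 hmR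
  have hnorm : ‖w‖ = ((Site.supNorm w : ℕ) : ℝ) := Site.norm_eq_supNorm w
  have hx := hwin (Site.supNorm w) R hm1 hmR
  have hx0 : (0:ℝ) ≤ (R:ℝ) / (Site.supNorm w : ℕ) := by positivity
  have hupos : 0 < ((R:ℝ) / (Site.supNorm w : ℕ)) ^ (-((3:ℝ) / 2 - ε)) :=
    Real.rpow_pos_of_pos (div_pos hRpos hmpos) _
  -- square the window inequality
  have hsq := pow_le_pow_left₀ (mul_nonneg (mul_nonneg hc.le hupos.le) ham) hx 2
  have hu2 : (((R:ℝ) / (Site.supNorm w : ℕ)) ^ (-((3:ℝ) / 2 - ε))) ^ 2 =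
      ((Site.supNorm w : ℕ) : ℝ) ^ ((3:ℝ) - 2 * ε) / (R : ℝ) ^ ((3:ℝ) - 2 * ε) := by
    rw [← Real.rpow_two, ← Real.rpow_mul hx0,
      show -((3:ℝ) / 2 - ε) * 2 = -((3:ℝ) - 2 * ε) by ring, Real.rpow_neg hx0,
      Real.div_rpow hRpos.le hmpos.le, inv_div]
  rw [mul_pow, mul_pow, hu2] at hsq
  have hRq : 0 < (R:ℝ) ^ ((3:ℝ) - 2 * ε) := Real.rpow_pos_of_pos hRpos _
  have hmq : 0 < ((Site.supNorm w : ℕ) : ℝ) ^ ((3:ℝ) - 2 * ε) := Real.rpow_pos_of_pos hmpos _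
  have hGw2 : criticalTwoPoint 3 w ^ 2 ≤ criticalTwoPoint 3 (Pi.single 0 (Site.supNorm w : ℤ)) ^ 2 :=
    pow_le_pow_left₀ h0w hGw 2
  refine hGw2.trans ?_
  rw [hnorm, Real.rpow_neg hmpos.le,
    show criticalTwoPoint 3 (Pi.single 0 (R : ℤ)) ^ 2 * (R:ℝ) ^ ((3:ℝ) - 2 * ε) / c ^ 2 *
        (((Site.supNorm w : ℕ) : ℝ) ^ ((3:ℝ) - 2 * ε))⁻¹ =
      criticalTwoPoint 3 (Pi.single 0 (R : ℤ)) ^ 2 * (R:ℝ) ^ ((3:ℝ) - 2 * ε) /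
        (c ^ 2 * ((Site.supNorm w : ℕ) : ℝ) ^ ((3:ℝ) - 2 * ε)) by
      field_simp,
    le_div_iff₀ (by positivity)]
  have h := mul_le_mul_of_nonneg_right hsq hRq.le
  calc criticalTwoPoint 3 (Pi.single 0 ((Site.supNorm w : ℕ) : ℤ)) ^ 2 *
        (c ^ 2 * ((Site.supNorm w : ℕ) : ℝ) ^ ((3:ℝ) - 2 * ε))
      = c ^ 2 * (((Site.supNorm w : ℕ) : ℝ) ^ ((3:ℝ) - 2 * ε) / (R : ℝ) ^ ((3:ℝ) - 2 * ε)) *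
          criticalTwoPoint 3 (Pi.single 0 ((Site.supNorm w : ℕ) : ℤ)) ^ 2 *
          (R : ℝ) ^ ((3:ℝ) - 2 * ε) := by
        field_simp
    _ ≤ criticalTwoPoint 3 (Pi.single 0 (R : ℤ)) ^ 2 * (R : ℝ) ^ ((3:ℝ) - 2 * ε) := h

/-- Zero term. WINDOW between the scales `1 ≤ R` gives `c² a_1² ≤ R³ a_R²`. [folklore] -/
theorem window_sq_axis_one_le {ε c : ℝ} (hε : 0 < ε) (hc : 0 < c)
    (hwin : ∀ m n : ℕ, 1 ≤ m → m ≤ n →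
      c * ((n : ℝ) / m) ^ (-((3:ℝ) / 2 - ε)) * criticalTwoPoint 3 (Pi.single 0 (m : ℤ)) ≤
        criticalTwoPoint 3 (Pi.single 0 (n : ℤ)))
    {R : ℕ} (hR : 1 ≤ R) :
    c ^ 2 * criticalTwoPoint 3 (Pi.single 0 ((1:ℕ) : ℤ)) ^ 2 ≤
      (R : ℝ) ^ 3 * criticalTwoPoint 3 (Pi.single 0 (R : ℤ)) ^ 2 := by
  have h := hwin 1 R le_rfl hR
  rw [Nat.cast_one, div_one] at h
  have hRpos : (0:ℝ) < R := by exact_mod_cast hR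
  have h1R : (1:ℝ) ≤ R := by exact_mod_cast hR
  have hv : 0 < (R:ℝ) ^ (-((3:ℝ) / 2 - ε)) := Real.rpow_pos_of_pos hRpos _
  have ha1 : 0 ≤ criticalTwoPoint 3 (Pi.single 0 ((1:ℕ) : ℤ)) := criticalTwoPoint_nonneg' _
  have hsq := pow_le_pow_left₀ (mul_nonneg (mul_nonneg hc.le hv.le) ha1) h 2
  have hv2 : ((R:ℝ) ^ (-((3:ℝ) / 2 - ε))) ^ 2 = ((R:ℝ) ^ ((3:ℝ) - 2 * ε))⁻¹ := by
    rw [← Real.rpow_two, ← Real.rpow_mul hRpos.le,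
      show -((3:ℝ) / 2 - ε) * 2 = -((3:ℝ) - 2 * ε) by ring, Real.rpow_neg hRpos.le]
  rw [mul_pow, mul_pow, hv2] at hsq
  have hRq : 0 < (R:ℝ) ^ ((3:ℝ) - 2 * ε) := Real.rpow_pos_of_pos hRpos _
  have hR3 : (R:ℝ) ^ ((3:ℝ) - 2 * ε) ≤ (R:ℝ) ^ 3 := by
    calc (R:ℝ) ^ ((3:ℝ) - 2 * ε) ≤ (R:ℝ) ^ ((3:ℕ) : ℝ) :=
          Real.rpow_le_rpow_of_exponent_le h1R (by push_cast; linarith)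
      _ = (R:ℝ) ^ 3 := Real.rpow_natCast _ 3
  have haR : 0 ≤ criticalTwoPoint 3 (Pi.single 0 (R : ℤ)) ^ 2 := sq_nonneg _
  -- from `c² (R^q)⁻¹ a_1² ≤ a_R²` get `c² a_1² ≤ R^q a_R² ≤ R³ a_R²`
  have h' := mul_le_mul_of_nonneg_right hsq hRq.le
  calc c ^ 2 * criticalTwoPoint 3 (Pi.single 0 ((1:ℕ) : ℤ)) ^ 2
      = c ^ 2 * ((R:ℝ) ^ ((3:ℝ) - 2 * ε))⁻¹ * criticalTwoPoint 3 (Pi.single 0 ((1:ℕ) : ℤ)) ^ 2 *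
          (R:ℝ) ^ ((3:ℝ) - 2 * ε) := by
        field_simp
    _ ≤ criticalTwoPoint 3 (Pi.single 0 (R : ℤ)) ^ 2 * (R:ℝ) ^ ((3:ℝ) - 2 * ε) := h'
    _ ≤ criticalTwoPoint 3 (Pi.single 0 (R : ℤ)) ^ 2 * (R:ℝ) ^ 3 :=
        mul_le_mul_of_nonneg_left hR3 haR
    _ = (R : ℝ) ^ 3 * criticalTwoPoint 3 (Pi.single 0 (R : ℤ)) ^ 2 := mul_comm _ _

/-- **WINDOW ⇒ top-heavy bubble** (item stmt-CriticalPhenomena-5509 of route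
LatticeSDPCertificates): if `c (n/m)^{-(3/2-ε)} ⟨σ₀σ_{me₁}⟩ ≤ ⟨σ₀σ_{ne₁}⟩` for all `1 ≤ m ≤ n`
at `β_c(3)`, then `Σ_{w ∈ Λ_R} ⟨σ₀σ_w⟩² ≤ C R³ ⟨σ₀σ_{Re₁}⟩²` for all `R ≥ 1`, with
`C = 1/(c² ⟨σ₀σ_{e₁}⟩²) + 54/(2ε' c²)`, `ε' = min ε ½`. [folklore] -/
theorem windowGivesTopHeavyBubble_proof : WindowGivesTopHeavyBubble := by
  unfold WindowGivesTopHeavyBubble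
  rintro ⟨ε₀, c, hε₀, hc, hwin₀⟩
  -- shrink the exponent gain to `ε = min ε₀ ½`
  obtain ⟨ε, hε, hε1, hwin⟩ : ∃ ε : ℝ, 0 < ε ∧ ε ≤ 1 / 2 ∧ ∀ m n : ℕ, 1 ≤ m → m ≤ n →
      c * ((n : ℝ) / m) ^ (-((3:ℝ) / 2 - ε)) * criticalTwoPoint 3 (Pi.single 0 (m : ℤ)) ≤
        criticalTwoPoint 3 (Pi.single 0 (n : ℤ)) := by
    refine ⟨min ε₀ (1 / 2), lt_min hε₀ (by norm_num), min_le_right _ _, fun m n hm hmn => ?_⟩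
    refine le_trans ?_ (hwin₀ m n hm hmn)
    have hmpos : (0:ℝ) < m := by exact_mod_cast hm
    have hx1 : (1:ℝ) ≤ (n:ℝ) / m := by
      rw [le_div_iff₀ hmpos, one_mul]
      exact_mod_cast hmn
    have hexp : -((3:ℝ) / 2 - min ε₀ (1 / 2)) ≤ -((3:ℝ) / 2 - ε₀) := by
      have := min_le_left ε₀ (1 / 2)
      linarith
    exact mul_le_mul_of_nonneg_right
      (mul_le_mul_of_nonneg_left (Real.rpow_le_rpow_of_exponent_le hx1 hexp) hc.le)
      (criticalTwoPoint_nonneg' _)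
  have hp0 : 0 < 2 * ε := by linarith
  have hp1 : 2 * ε ≤ 1 := by linarith
  have ha1pos : 0 < criticalTwoPoint 3 (Pi.single 0 ((1:ℕ) : ℤ)) := criticalTwoPoint_axis_pos 1
  refine ⟨1 / (c ^ 2 * criticalTwoPoint 3 (Pi.single 0 ((1:ℕ) : ℤ)) ^ 2) + 54 / (c ^ 2 * (2 * ε)),
    fun R hR => ?_⟩
  have hRpos : (0:ℝ) < R := by exact_mod_cast hR
  -- split off the term `w = 0`
  rw [← Finset.add_sum_erase _ _ (zero_mem_box 3 R), criticalTwoPoint_zero', one_pow, add_mul,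
    add_mul]
  refine add_le_add ?_ ?_
  · -- the zero term: `1 ≤ R³ a_R² / (c² a_1²)`
    have hz := window_sq_axis_one_le hε hc hwin hR
    rw [mul_assoc, one_div_mul_eq_div, le_div_iff₀ (by positivity), one_mul]
    linarith
  · -- the terms `w ≠ 0`
    have hpt : ∀ w ∈ (box 3 R).erase 0, criticalTwoPoint 3 w ^ 2 ≤
        criticalTwoPoint 3 (Pi.single 0 (R : ℤ)) ^ 2 * (R:ℝ) ^ ((3:ℝ) - 2 * ε) / c ^ 2 *
          ‖w‖ ^ (-((3:ℝ) - 2 * ε)) :=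
      fun w hw => criticalTwoPoint_sq_le_of_window hc hwin (Finset.ne_of_mem_erase hw)
        (Finset.mem_of_mem_erase hw)
    have hK : 0 ≤ criticalTwoPoint 3 (Pi.single 0 (R : ℤ)) ^ 2 * (R:ℝ) ^ ((3:ℝ) - 2 * ε) / c ^ 2 := by
      positivity
    have h3 : (R:ℝ) ^ ((3:ℝ) - 2 * ε) * (R:ℝ) ^ (2 * ε) = (R:ℝ) ^ 3 := by
      rw [← Real.rpow_add hRpos, show (3:ℝ) - 2 * ε + 2 * ε = ((3:ℕ) : ℝ) by push_cast; ring,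
        Real.rpow_natCast]
    calc ∑ w ∈ (box 3 R).erase 0, criticalTwoPoint 3 w ^ 2
        ≤ ∑ w ∈ (box 3 R).erase 0,
            criticalTwoPoint 3 (Pi.single 0 (R : ℤ)) ^ 2 * (R:ℝ) ^ ((3:ℝ) - 2 * ε) / c ^ 2 *
              ‖w‖ ^ (-((3:ℝ) - 2 * ε)) := Finset.sum_le_sum hpt
      _ = criticalTwoPoint 3 (Pi.single 0 (R : ℤ)) ^ 2 * (R:ℝ) ^ ((3:ℝ) - 2 * ε) / c ^ 2 *
            ∑ w ∈ (box 3 R).erase 0, ‖w‖ ^ (-((3:ℝ) - 2 * ε)) := by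
          rw [Finset.mul_sum]
      _ ≤ criticalTwoPoint 3 (Pi.single 0 (R : ℤ)) ^ 2 * (R:ℝ) ^ ((3:ℝ) - 2 * ε) / c ^ 2 *
            (54 * ∑ m ∈ Finset.range R, ((m:ℝ) + 1) ^ (2 - ((3:ℝ) - 2 * ε))) :=
          mul_le_mul_of_nonneg_left (sum_box_erase_norm_rpow_le _ R) hK
      _ ≤ criticalTwoPoint 3 (Pi.single 0 (R : ℤ)) ^ 2 * (R:ℝ) ^ ((3:ℝ) - 2 * ε) / c ^ 2 *
            (54 * ((R:ℝ) ^ (2 * ε) / (2 * ε))) := by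
          refine mul_le_mul_of_nonneg_left (mul_le_mul_of_nonneg_left ?_ (by norm_num)) hK
          rw [show (2:ℝ) - (3 - 2 * ε) = 2 * ε - 1 by ring]
          exact sum_range_rpow_sub_one_le hp0 hp1 R
      _ = 54 / (c ^ 2 * (2 * ε)) * ((R:ℝ) ^ ((3:ℝ) - 2 * ε) * (R:ℝ) ^ (2 * ε)) *
            criticalTwoPoint 3 (Pi.single 0 (R : ℤ)) ^ 2 := by
          ring
      _ = 54 / (c ^ 2 * (2 * ε)) * (R:ℝ) ^ 3 * criticalTwoPoint 3 (Pi.single 0 (R : ℤ)) ^ 2 := by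
          rw [h3]

end Summit.CriticalPhenomena.Ising3DConformalLimit.Theorems
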